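import Summits.NavierStokesRegularity.NavierStokesRegularity.Theorems.ExtremiserTransienceNearExtremalTransienceExtremiserLiouvilleArrayField
import HarnessLib

/-!
# Crux `ExtremiserTransience.NearExtremalTransience` (stmt-NavierStokesRegularity-21883), line `extremiser_liouville`,
# stub K1b — «NO GAIN FROM CONSTANTS», file 5/5: THE THEOREM `noGainFromConstants`

`--supports stmt-NavierStokesRegularity-21883` (helper).  Author: prover seat `ns-el-k1b` (g0).

**THEOREM (`noGainFromConstants`).**  For every `C^∞`, compactly supported, divergence-free `u : ℝ³ → ℝ³`, every constant
`b ∈ ℝ³` and every `M` with `‖u(x) + b‖ ≤ M` for all `x`: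
`|∫⟪curl u, Du curl u⟫| ≤ κ⋆ · M · ‖curl u‖₂ · ‖∇ curl u‖₂`, `κ⋆ = sInf V` the tree's sharp depletion constant
(`DepletionLadder.sharpDepletion_*`).  So the efficiency of an admissible field cannot be pushed above `κ⋆` by measuring its
amplitude modulo constants (`efficiency_shift_le_kStar`), although `u + b` itself is NOT admissible (not `L²`).

PROOF.  Place `N³` disjoint translates of `u` inside the plateau of the carrier `Φ_{b,L_N}`, `L_N = 2sN + R + 1` (file 4/5):
an ADMISSIBLE field with sup `≤ M`, to which `κ⋆` applies (`sharpDepletion_is_universal`):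
`|N³S(u) + S(Φ_b)| ≤ κ⋆ M √(N³Z(u) + L_N Z(Φ_b)) √(N³P(u) + P(Φ_b)/L_N)`.  The carrier costs enstrophy `O(N)` and palinstrophy
`O(1)` against the array's `N³` — a SINGLE copy could never be cut off this cheaply (an `L²` field equal to `b` on `B_L`
has enstrophy `≳ ‖b‖²L` by Sobolev), the array amortises it.  Divide by `N⁶` after squaring and let `N → ∞`
(`sq_le_of_array_ineq`, `le_of_forall_nat_sq`).

BEARING ON K1B (recorded, not claimed): the line card's instrument I1 (kit j301175/j301210) and failure mode «GAIN FROM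
CONSTANTS» asked whether near-maximisers of the efficiency can lower their sup norm by a constant shift and so produce
analytic `κ⋆`-super-efficient fields of the extended (non-`L²`) class; this theorem answers NO for the whole `C^∞_c` class, by
proof rather than by optimiser evidence.  What remains of K1b after `…NoAnalyticExtremalSqIntegrable` (stratum `w ∈ L²`,
proved) and this file: (i) the density step from `C^∞_c` to the decaying tail `w − b` of a field of the stub's class
(`Dw ∈ L² ∩ L^∞`, `D²w ∈ L²`, no `L²`), and (ii) the EQUALITY case `|S| = κ⋆ M ‖ω‖₂‖∇ω‖₂` for analytic non-`L²` fields,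
including the «plateau at infinity» `‖lim_∞ w‖ = sup ‖w‖` (where the two-sided first variation of the tree's
`KStar.interior_contact_nonempty` is unavailable).  K1b is a STATIC statement about analytic κ⋆-efficient fields; the crux NET, rung N0 and NS regularity stay OPEN — nothing here proves NS regularity. [folklore]
-/

noncomputable section

open Set Filter Topology MeasureTheory Metric
open scoped InnerProductSpace RealInnerProductSpace ENNReal NNReal ContDiff
open Literature.Analysis.FluidPDE

namespace Summit.NavierStokesRegularity.NavierStokesRegularity.Theorems

-- the problem directory repeats the summit name (`NavierStokesRegularity/NavierStokesRegularity`)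
set_option linter.dupNamespace false

namespace ExtremiserLiouville

open DepletionLadder.KStar.HalfSpace (E3)

/-! ## The limit `N → ∞` (elementary real analysis) -/

/-- If `a ≤ K + C/n²` for every integer `n ≥ 1` (`C ≥ 0`) then `a ≤ K`. [folklore] -/
theorem le_of_forall_nat_sq {a K C : ℝ} (hC : 0 ≤ C) (h : ∀ n : ℕ, 1 ≤ n → a ≤ K + C / (n : ℝ) ^ 2) : a ≤ K := by
  refine le_of_forall_pos_le_add fun ε hε => ?_
  obtain ⟨n, hn⟩ := exists_nat_gt (C / ε)
  have hn0 : (0 : ℝ) < n := lt_of_le_of_lt (div_nonneg hC hε.le) hn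
  have hn1 : 1 ≤ n := Nat.one_le_iff_ne_zero.2 (by rintro rfl; simp at hn0)
  have hn1' : (1 : ℝ) ≤ n := by exact_mod_cast hn1
  have h1 := h n hn1
  have h2 : C / (n : ℝ) ^ 2 ≤ C / n := by
    apply div_le_div_of_nonneg_left hC hn0
    nlinarith
  have h3 : C / (n : ℝ) < ε := by
    rw [div_lt_iff₀ hn0]
    rw [div_lt_iff₀ hε] at hn
    linarith
  linarith

/-- **The array inequality in the limit.** If for every `n ≥ 1`
`(n³S + S₁)² ≤ K·(n³Z + L_n Z₁)(n³P + P₁/L_n)` with `L_n = αn + β` (`α ≥ 0 < β`, all data `≥ 0`), then `S² ≤ K·Z·P`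
(divide by `n⁶`: the carrier's enstrophy `L_n Z₁ = O(n)` and palinstrophy `P₁/L_n = O(1)` are `o(n³)`). [folklore] -/
theorem sq_le_of_array_ineq {S Z P S₁ Z₁ P₁ K α β : ℝ} (hZ : 0 ≤ Z) (hP : 0 ≤ P) (hZ₁ : 0 ≤ Z₁) (hP₁ : 0 ≤ P₁)
    (hK : 0 ≤ K) (hα : 0 ≤ α) (hβ : 0 < β)
    (h : ∀ n : ℕ, 1 ≤ n → ((n : ℝ) ^ 3 * S + S₁) ^ 2 ≤
      K * (((n : ℝ) ^ 3 * Z + (α * n + β) * Z₁) * ((n : ℝ) ^ 3 * P + (α * n + β)⁻¹ * P₁))) :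
    S ^ 2 ≤ K * (Z * P) := by
  set C := K * (Z * P₁ / β + P * (α + β) * Z₁ + Z₁ * P₁) + 2 * |S * S₁| with hCdef
  have hC : 0 ≤ C := by positivity
  refine le_of_forall_nat_sq hC fun n hn1 => ?_
  have hn : (1 : ℝ) ≤ n := by exact_mod_cast hn1
  have hn0 : (0 : ℝ) < n := by linarith
  set m : ℝ := (n : ℝ) with hm
  set L := α * m + β with hLdef
  have hLβ : β ≤ L := by rw [hLdef]; nlinarith
  have hLpos : 0 < L := lt_of_lt_of_le hβ hLβ
  have hLle : L ≤ (α + β) * m := by rw [hLdef]; nlinarith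
  have hmain := h n hn1
  -- expand the right-hand side
  have e1 : (m ^ 3 * Z + L * Z₁) * (m ^ 3 * P + L⁻¹ * P₁) =
      m ^ 6 * (Z * P) + m ^ 3 * Z * P₁ * L⁻¹ + m ^ 3 * P * L * Z₁ + Z₁ * P₁ := by
    field_simp
    ring
  have hm34 : m ^ 3 ≤ m ^ 4 := pow_le_pow_right₀ hn (by norm_num)
  have hm04 : (1 : ℝ) ≤ m ^ 4 := one_le_pow₀ hn
  have b1 : m ^ 3 * Z * P₁ * L⁻¹ ≤ m ^ 4 * (Z * P₁ / β) := by
    have hinv : L⁻¹ ≤ β⁻¹ := inv_anti₀ hβ hLβ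
    calc m ^ 3 * Z * P₁ * L⁻¹ ≤ m ^ 4 * Z * P₁ * β⁻¹ := by gcongr
      _ = m ^ 4 * (Z * P₁ / β) := by rw [div_eq_mul_inv]; ring
  have b2 : m ^ 3 * P * L * Z₁ ≤ m ^ 4 * (P * (α + β) * Z₁) := by
    calc m ^ 3 * P * L * Z₁ ≤ m ^ 3 * P * ((α + β) * m) * Z₁ := by gcongr
      _ = m ^ 4 * (P * (α + β) * Z₁) := by ring
  have b3 : Z₁ * P₁ ≤ m ^ 4 * (Z₁ * P₁) := le_mul_of_one_le_left (mul_nonneg hZ₁ hP₁) hm04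
  have lhs : m ^ 6 * S ^ 2 - m ^ 4 * (2 * |S * S₁|) ≤ (m ^ 3 * S + S₁) ^ 2 := by
    have h1 : -|S * S₁| ≤ S * S₁ := neg_abs_le _
    have h2 : 0 ≤ |S * S₁| := abs_nonneg _
    nlinarith [sq_nonneg S₁, mul_nonneg (sub_nonneg.2 hm34) h2]
  have key : m ^ 6 * S ^ 2 ≤ m ^ 6 * (K * (Z * P)) + m ^ 4 * C := by
    have : K * ((m ^ 3 * Z + L * Z₁) * (m ^ 3 * P + L⁻¹ * P₁)) ≤
        K * (m ^ 6 * (Z * P) + m ^ 4 * (Z * P₁ / β) + m ^ 4 * (P * (α + β) * Z₁) + m ^ 4 * (Z₁ * P₁)) := by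
      rw [e1]; gcongr
    rw [hCdef]
    nlinarith
  have hm6 : (0 : ℝ) < m ^ 6 := by positivity
  have hdiv : m ^ 4 * C / m ^ 6 = C / m ^ 2 := by
    field_simp
  calc S ^ 2 = m ^ 6 * S ^ 2 / m ^ 6 := by field_simp
    _ ≤ (m ^ 6 * (K * (Z * P)) + m ^ 4 * C) / m ^ 6 := by gcongr
    _ = K * (Z * P) + C / m ^ 2 := by rw [add_div, hdiv]; field_simp

/-- Auxiliary (`sq_le_of_abs_le_sqrt`): `|A| ≤ c√B√D ⇒ A² ≤ c²(BD)` (`B, D ≥ 0`). [folklore] -/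
theorem sq_le_of_abs_le_sqrt {A B D c : ℝ} (hB : 0 ≤ B) (hD : 0 ≤ D)
    (h : |A| ≤ c * Real.sqrt B * Real.sqrt D) : A ^ 2 ≤ c ^ 2 * (B * D) := by
  have h2 := pow_le_pow_left₀ (abs_nonneg A) h 2
  rw [sq_abs, mul_pow, mul_pow, Real.sq_sqrt hB, Real.sq_sqrt hD] at h2
  linarith

/-! ## NO GAIN FROM CONSTANTS -/

/-- **NO GAIN FROM CONSTANTS (the «one new variational fact» of line `extremiser_liouville`, PROVED).**
For every `C^∞`, compactly supported, divergence-free field `u` on `ℝ³`, every constant vector `b` and every bound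
`M ≥ ‖u + b‖`, the stretching integral obeys the SHARP depletion inequality with the sup norm of the SHIFTED field:
`|∫⟪ω, Du ω⟫| ≤ κ⋆ · M · ‖ω‖₂ · ‖∇ω‖₂` (`ω = curl u`, `κ⋆ = sInf V` the tree's sharp constant).  Equivalently: the
efficiency `R[u] = |S|/(‖u‖_∞‖ω‖₂‖∇ω‖₂)` of an admissible field cannot be pushed above `κ⋆` by measuring the amplitude
modulo constants (`‖u + b‖_∞` in place of `‖u‖_∞`), although `u + b` itself is not admissible (not `L²`).
Proof: the `N³`-array of disjoint translates of `u` inside the plateau of the carrier `Φ_{b,L_N}` (file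
`…ExtremiserLiouvilleConstantCarrier`) is an honest admissible field with `‖·‖ ≤ M`, to which `κ⋆` applies
(`sharpDepletion_is_universal`); its data are `N³S(u) + S(Φ_b)`, `N³Z(u) + L_N Z(Φ_b)`, `N³P(u) + P(Φ_b)/L_N`
(`integrals_testField`), and `N → ∞` (`sq_le_of_array_ineq`).  WHAT THIS IS NOT: not the stub K1b (which concerns
analytic NON-compactly-supported fields and the equality case); nothing about Navier–Stokes. [folklore] -/
theorem noGainFromConstants {u : E3 → E3} (hu : ContDiff ℝ ∞ u) (huc : HasCompactSupport u)
    (hdiv : VectorCalculus.IsDivFree u) (b : E3) {M : ℝ} (hM : ∀ x, ‖u x + b‖ ≤ M) :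
    |∫ x, ⟪curl u x, fderiv ℝ u x (curl u x)⟫| ≤
      sInf {κ : ℝ | (∀ (v : EuclideanSpace ℝ (Fin 3) → EuclideanSpace ℝ (Fin 3)) (M B : ℝ), ContDiff ℝ (⊤ : ℕ∞) v → Literature.Analysis.FluidPDE.VectorCalculus.IsDivFree v → (∀ x, ‖v x‖ ≤ M) → (∀ x, ‖fderiv ℝ v x‖ ≤ B) → (∫⁻ x, ‖iteratedFDeriv ℝ 0 v x‖ₑ ^ 2 < ⊤) → (∫⁻ x, ‖iteratedFDeriv ℝ 1 v x‖ₑ ^ 2 < ⊤) → (∫⁻ x, ‖iteratedFDeriv ℝ 2 v x‖ₑ ^ 2 < ⊤) → |∫ x, ⟪Literature.Analysis.FluidPDE.curl v x, fderiv ℝ v x (Literature.Analysis.FluidPDE.curl v x)⟫_ℝ| ≤ κ * M * Real.sqrt (∫ x, ‖Literature.Analysis.FluidPDE.curl v x‖ ^ 2) * Real.sqrt (∫ x, Literature.Analysis.FluidPDE.frobeniusNormSq (fderiv ℝ (Literature.Analysis.FluidPDE.curl v) x)))} * M *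
        Real.sqrt (∫ x, ‖curl u x‖ ^ 2) * Real.sqrt (∫ x, frobeniusNormSq (fderiv ℝ (curl u) x)) := by
  set κ : ℝ := sInf {κ : ℝ | (∀ (v : EuclideanSpace ℝ (Fin 3) → EuclideanSpace ℝ (Fin 3)) (M B : ℝ), ContDiff ℝ (⊤ : ℕ∞) v → Literature.Analysis.FluidPDE.VectorCalculus.IsDivFree v → (∀ x, ‖v x‖ ≤ M) → (∀ x, ‖fderiv ℝ v x‖ ≤ B) → (∫⁻ x, ‖iteratedFDeriv ℝ 0 v x‖ₑ ^ 2 < ⊤) → (∫⁻ x, ‖iteratedFDeriv ℝ 1 v x‖ₑ ^ 2 < ⊤) → (∫⁻ x, ‖iteratedFDeriv ℝ 2 v x‖ₑ ^ 2 < ⊤) → |∫ x, ⟪Literature.Analysis.FluidPDE.curl v x, fderiv ℝ v x (Literature.Analysis.FluidPDE.curl v x)⟫_ℝ| ≤ κ * M * Real.sqrt (∫ x, ‖Literature.Analysis.FluidPDE.curl v x‖ ^ 2) * Real.sqrt (∫ x, Literature.Analysis.FluidPDE.frobeniusNormSq (fderiv ℝ (Literature.Analysis.FluidPDE.curl v)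 x)))} with hκdef
  have hκ0 : 0 ≤ κ := le_trans (by norm_num) DepletionLadder.sharpDepletion_gt.le
  -- geometry of the support
  obtain ⟨R₀, hR₀⟩ := (huc.isCompact.isBounded).subset_closedBall (0 : E3)
  set R := max R₀ 0 with hRdef
  have hR0 : 0 ≤ R := le_max_right _ _
  have hsupp : tsupport u ⊆ closedBall (0 : E3) R := hR₀.trans (closedBall_subset_closedBall (le_max_left _ _))
  set s := 2 * R + 1 with hsdef
  have hs : 2 * R < s := by rw [hsdef]; linarith
  -- `‖b‖ ≤ M`
  obtain ⟨x₀, hx₀⟩ := NormedSpace.exists_lt_norm ℝ E3 R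
  have hbM : ‖b‖ ≤ M := by
    have hx₀' : x₀ ∉ tsupport u := by
      intro h
      have := hsupp h
      rw [mem_closedBall, dist_zero_right] at this
      linarith
    have h := hM x₀
    rwa [image_eq_zero_of_notMem_tsupport hx₀', zero_add] at h
  -- the data
  set S := ∫ x, sig u x with hSdef
  set Z := ∫ x, zet u x with hZdef
  set P := ∫ x, pal u x with hPdef
  set S₁ := ∫ x, sig (carrier b) x with hS₁def
  set Z₁ := ∫ x, zet (carrier b) x with hZ₁def
  set P₁ := ∫ x, pal (carrier b) x with hP₁def
  have hZ : 0 ≤ Z := integral_nonneg fun x => sq_nonneg _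
  have hP : 0 ≤ P := integral_nonneg fun x => frobeniusNormSq_nonneg _
  have hZ₁ : 0 ≤ Z₁ := integral_nonneg fun x => sq_nonneg _
  have hP₁ : 0 ≤ P₁ := integral_nonneg fun x => frobeniusNormSq_nonneg _
  -- the inequality for the N-th test field
  have hN : ∀ n : ℕ, 1 ≤ n → ((n : ℝ) ^ 3 * S + S₁) ^ 2 ≤
      (κ * M) ^ 2 * (((n : ℝ) ^ 3 * Z + (2 * s * n + (R + 1)) * Z₁) * ((n : ℝ) ^ 3 * P + (2 * s * n + (R + 1))⁻¹ * P₁)) := by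
    intro n _
    set L := 2 * s * n + (R + 1) with hLdef
    have hL : 2 * s * n + R < L := by rw [hLdef]; linarith
    have hcd := contDiff_testField b hu s n L
    have hcs := hasCompactSupport_testField b hR0 hsupp hs hL
    have hdv := isDivFree_testField b hR0 hsupp hs hL hdiv
    obtain ⟨⟨B, hB⟩, h0, h1, h2⟩ := admissible_of_compactSupport hcd hcs
    have hsup := norm_testField_le b hR0 hsupp hs hL hM hbM
    have huniv : |∫ x, sig (testField u b s n L) x| ≤
        κ * M * Real.sqrt (∫ x, zet (testField u b s n L) x) * Real.sqrt (∫ x, pal (testField u b s n L) x) :=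
      DepletionLadder.sharpDepletion_is_universal (testField u b s n L) M B hcd hdv hsup hB h0 h1 h2
    obtain ⟨e1, e2, e3⟩ := integrals_testField b hR0 hsupp hs hL hu huc
    rw [e1, e2, e3] at huniv
    have hZn : 0 ≤ (n : ℝ) ^ 3 * Z + L * Z₁ := by positivity
    have hPn : 0 ≤ (n : ℝ) ^ 3 * P + L⁻¹ * P₁ := by
      have : 0 < L := by rw [hLdef]; positivity
      positivity
    exact sq_le_of_abs_le_sqrt hZn hPn huniv
  have hsq := sq_le_of_array_ineq hZ hP hZ₁ hP₁ (sq_nonneg (κ * M)) (by positivity : (0:ℝ) ≤ 2 * s)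
    (by positivity : (0:ℝ) < R + 1) hN
  -- take square roots
  have hκM : 0 ≤ κ * M := mul_nonneg hκ0 ((norm_nonneg b).trans hbM)
  have h := Real.abs_le_sqrt hsq
  rw [Real.sqrt_mul (sq_nonneg _), Real.sqrt_sq hκM, Real.sqrt_mul hZ] at h
  show |S| ≤ κ * M * Real.sqrt Z * Real.sqrt P
  linarith [h, mul_assoc (κ * M) (Real.sqrt Z) (Real.sqrt P)]

/-- **Corollary (efficiency form): constants never raise the efficiency above `κ⋆`.**  If `u ∈ C^∞_c` is divergence
free with `‖curl u‖₂‖∇curl u‖₂ > 0`, then for every constant `b` and every `M ≥ ‖u + b‖`,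
`|S(u)| / (M·‖ω‖₂‖∇ω‖₂) ≤ κ⋆`. [folklore] -/
theorem efficiency_shift_le_kStar {u : E3 → E3} (hu : ContDiff ℝ ∞ u) (huc : HasCompactSupport u)
    (hdiv : VectorCalculus.IsDivFree u) (b : E3) {M : ℝ} (hM : ∀ x, ‖u x + b‖ ≤ M)
    (hpos : 0 < M * Real.sqrt (∫ x, ‖curl u x‖ ^ 2) * Real.sqrt (∫ x, frobeniusNormSq (fderiv ℝ (curl u) x))) :
    |∫ x, ⟪curl u x, fderiv ℝ u x (curl u x)⟫| /
        (M * Real.sqrt (∫ x, ‖curl u x‖ ^ 2) * Real.sqrt (∫ x, frobeniusNormSq (fderiv ℝ (curl u) x))) ≤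
      sInf {κ : ℝ | (∀ (v : EuclideanSpace ℝ (Fin 3) → EuclideanSpace ℝ (Fin 3)) (M B : ℝ), ContDiff ℝ (⊤ : ℕ∞) v → Literature.Analysis.FluidPDE.VectorCalculus.IsDivFree v → (∀ x, ‖v x‖ ≤ M) → (∀ x, ‖fderiv ℝ v x‖ ≤ B) → (∫⁻ x, ‖iteratedFDeriv ℝ 0 v x‖ₑ ^ 2 < ⊤) → (∫⁻ x, ‖iteratedFDeriv ℝ 1 v x‖ₑ ^ 2 < ⊤) → (∫⁻ x, ‖iteratedFDeriv ℝ 2 v x‖ₑ ^ 2 < ⊤) → |∫ x, ⟪Literature.Analysis.FluidPDE.curl v x, fderiv ℝ v x (Literature.Analysis.FluidPDE.curl v x)⟫_ℝ| ≤ κ * M * Real.sqrt (∫ x, ‖Literature.Analysis.FluidPDE.curl v x‖ ^ 2) * Real.sqrt (∫ x, Literature.Analysis.FluidPDE.frobeniusNormSq (fderiv ℝ (Literature.Analysis.FluidPDE.curl v) x)))} := by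
  rw [div_le_iff₀ hpos]
  refine le_of_le_of_eq (noGainFromConstants hu huc hdiv b hM) ?_
  ring

end ExtremiserLiouville

end Summit.NavierStokesRegularity.NavierStokesRegularity.Theorems

end
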